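import Literature.Computability.Complexity.DiscreteTomographyPyramids
import Literature.Computability.Complexity.CanonicalCodes
import Literature.Computability.Complexity.ListFoldBricks
import HarnessLib

/-!
# Fischer–Ikenmeyer 2020, Lemma 5: the reduction machine and the discharge of
# `FischerIkenmeyer2020_lemma5`

N. Fischer, C. Ikenmeyer, *The computational complexity of plethysm coefficients*, Comput.
Complexity 29 (2020), Lemma 5: "There exists a parsimonious polynomial-time reduction from
SYMMETRIC-2D-X-RAY to PROMISE-SYMMETRIC-3D-X-RAY. Moreover, there exists a parsimonious
polynomial-time reduction from SKEW-SYMMETRIC-2D-X-RAY to PROMISE-SKEW-SYMMETRIC-3D-X-RAY."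
Printed proof (§6, after Lemma 7): "Given a (Skew-)Symmetric-2D-X-Ray instance `λ̂`, we first assert
that `|λ̂|` is divisible by `3` and that `B(λ̂) = rn` holds for `n = |λ̂|/3`. If this step fails, output
a trivially zero Symmetric instance. Otherwise, construct `λ := S(P̄_{r-1}) + λ̂` and output `λ` …
Clearly, this algorithm runs in polynomial time."

The list-level map `Tomography.reduceList K` and its correctness for both cones
(`Tomography.mem_symSetK_iff_reduceList_mem`, Lemmas 6–7) are in
`DiscreteTomographyPyramids.lean`. This file supplies "clearly, this algorithm runs in polynomial
time" for the tree's `TM2`-based class `FP`, on the codes of `DiscreteTomography.lean`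
(`encodingComposition = unaryEncodingNat.listBool`: `⟨1^{r+1}, ⟨1^{λ_0}, ⟨1^{λ_1}, … ⟨1^{λ_r}, ε⟩…⟩⟩⟩`),
by brick algebra only (no machine is written), uniformly in a strictness flag `s : Bool`
(`s = false`: closed cone `C̄`, comparisons `≤`; `s = true`: open cone `C`, comparisons `<`):

* `Tomography.isCanonFn` — the code test `[encode (decComp w) = w]` (`CanonCode.canonListFn onesFn` is
  `encode ∘ decode` for composition codes, `canonListFn_onesFn_eq`);
* `Tomography.testFn` — the one-bit test `[Good λ̂]` on codes `encode λ̂` (`testFn_wOf`): `|λ̂|` and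
  `B(λ̂) = Σ i λ̂_i` are sum folds (`Brick.foldLoop addFn`) of `lenBinF` / `prodFn` over the items,
  compared with `eqValFn` (`3 B = r |λ̂|`, `|λ̂| mod 3 = 0`, header nonempty);
* `Tomography.gF s`, `MF s`, `SF s` — the sum-marginal `S_i(P̄_{r-1})` in unary as the iterated
  indicator sum `Σ_{u ≤ r} Σ_{v ≤ r} ([(i,u,v) ∈ P̄_{r-1}] + [(u,i,v) ∈ P̄_{r-1}] + [(u,v,i) ∈ P̄_{r-1}])`
  (`Tomography.sumMarginal_pyrBelow_eq_sum_sum`): three nested concatenation folds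
  (`Brick.foldLoop appF`, clipped pieces `Brick.clipF`, unclipped on the genuine run by
  `Brick.foldAcc_clipF`) over unary indices, the indicators being length comparisons (`Brick.ltLenF`)
  of the unary coordinates;
* `Tomography.pieceF s`, `coreF s` — the output code assembled piece by piece,
  `⟨1^{r+1}, ccat_i ⟨1^{S_i + λ̂_i}, ε⟩⟩ = encode (addPyr K λ̂)` (`coreF_wOf`, `coreF_encode`), the context record
  carrying a quadratic pad `1^{|w|²}` as yardstick so that every piece is linearly bounded;
* `Tomography.redFn s := iteFn (isCanonFn ∧ testFn) (coreF s) badCode` (`badCode = encode [1]`),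
  `redFn_mem_FP`, and **`Tomography.karpReducible_of_cone`**: for every region `K` whose membership is
  the pair of comparisons selected by `s`, `redFn s` Karp-reduces the code language of `symSetK K` to
  that of `promiseSetK K`;
* **`Tomography.FischerIkenmeyer2020_lemma5_holds : FischerIkenmeyer2020_lemma5`** (both cones).

## References

* [FischerIkenmeyer2020] N. Fischer, C. Ikenmeyer, *The computational complexity of plethysm
  coefficients*, Comput. Complexity 29 (2020) 8, arXiv:2002.00788 (held), §3 (unary/binary input
  encodings), §6 (Problems 7, 10; Lemma 5 and its proof; Lemma 7).
* [AroraBarak2009] S. Arora, B. Barak, *Computational Complexity: A Modern Approach*, CUP 2009,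
  §1.3 (polynomial time is closed under composition and bounded loops), Def. 2.7.
-/

noncomputable section

namespace Literature.Computability.Complexity

namespace Tomography

open _root_.Computability Polynomial Brick HashBricks CanonCode Plumb OracleCompose
open scoped Notation

/-! ### Codes of compositions -/

/-- The code of a composition: unary header, then the unary items as a nested-pair list
(`OracleCompose.body`). [cite: FischerIkenmeyer2020, §3 ("encoded in binary or in unary")] -/
theorem encode_eq_boolPair_body (l : List ℕ) :
    encodingComposition.encode l = boolPair (ones l.length) (body (l.map ones)) := by
  show boolPair (unaryEncodeNat l.length)
    (l.foldr (fun a acc => boolPair (unaryEncodeNat a) acc) []) = _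
  rw [unaryEncodeNat_eq_replicate]
  congr 1
  induction l with
  | nil => rfl
  | cons a l ih => rw [List.foldr_cons, ih, List.map_cons, body_cons, unaryEncodeNat_eq_replicate]

/-- Length of the items part of a composition code: `2|λ| + 2(r+1)`. [folklore] -/
theorem length_body_map_ones (l : List ℕ) : (body (l.map ones)).length = 2 * l.sum + 2 * l.length := by
  induction l with
  | nil => rfl
  | cons a l ih =>
    simp only [List.map_cons, body_cons, length_boolPair, List.length_replicate, ih, List.sum_cons,
      List.length_cons]
    ring

/-- **Length of a composition code**: `|encode λ| = 4(r+1) + 2|λ| + 2`. [folklore] -/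
theorem length_encode (l : List ℕ) :
    (encodingComposition.encode l).length = 4 * l.length + 2 * l.sum + 2 := by
  rw [encode_eq_boolPair_body, length_boolPair, List.length_replicate, length_body_map_ones]
  ring

/-- An entry of a composition is at most its sum. [folklore] -/
theorem listFn_le_sum (l : List ℕ) (i : ℕ) : listFn l i ≤ l.sum := by
  by_cases hi : i < l.length
  · rw [sum_eq_sum_range_listFn]
    exact Finset.single_le_sum (f := listFn l) (fun _ _ => Nat.zero_le _) (Finset.mem_range.2 hi)
  · rw [listFn_of_le (not_lt.1 hi)]
    exact Nat.zero_le _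

/-- **The total decoder of composition codes** (`unaryDecodeNat = length` never fails): `|header|`
items read off the items part by `boolUnpair`. [folklore] -/
def decComp (w : List Bool) : List ℕ := NegCNF.decList List.length (boolUnpair w).1.length (boolUnpair w).2

/-- The decoder of `encodingComposition` is total with value `decComp`. [folklore] -/
theorem decode_eq_decComp (w : List Bool) : encodingComposition.decode w = some (decComp w) :=
  (canonListFn_eq unaryEncodingNat List.length (fun _ => rfl) (ci := onesFn) (fun _ => rfl) w).1

/-- **`canonListFn onesFn` is the re-encoding `encode ∘ decComp`** of composition codes. [folklore] -/
theorem canonListFn_onesFn_eq (w : List Bool) :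
    canonListFn onesFn w = encodingComposition.encode (decComp w) :=
  (canonListFn_eq unaryEncodingNat List.length (fun _ => rfl) (ci := onesFn) (fun _ => rfl) w).2

/-- The total decoder inverts the encoder. [folklore] -/
theorem decComp_encode (l : List ℕ) : decComp (encodingComposition.encode l) = l := by
  have h := decode_eq_decComp (encodingComposition.encode l)
  rw [encodingComposition.decode_encode] at h
  exact (Option.some.inj h).symm

/-- A member of a language of composition codes is a code. [folklore] -/
theorem encode_decComp_of_mem {S : Set (List ℕ)} {x : List Bool} (h : x ∈ encodingComposition.toLanguage S) :
    encodingComposition.encode (decComp x) = x := by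
  obtain ⟨l, -, rfl⟩ := h
  rw [decComp_encode]

/-- **The code test** `isCanonFn w = [encode (decComp w) = w]`. [cite: AroraBarak2009, §1.3] -/
def isCanonFn : List Bool → List Bool := eqPairFn ∘ fanoutFn (canonListFn onesFn) id

/-- `isCanonFn ∈ FP`. [cite: AroraBarak2009, §1.3] -/
theorem isCanonFn_mem_FP : isCanonFn ∈ FP :=
  comp_mem_FP eqPairFn_mem_FP (fanoutFn_mem_FP
    (canonListFn_mem_FP onesFn_mem_FP (a := 0) fun u => by rw [length_onesFn, Nat.add_zero]) id_mem_FP)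

/-- Value of the code test. [folklore] -/
theorem isCanonFn_apply (w : List Bool) :
    isCanonFn w = [decide (encodingComposition.encode (decComp w) = w)] := by
  rw [isCanonFn, Function.comp_apply, fanoutFn_apply, eqPairFn_boolPair, canonListFn_onesFn_eq]
  rfl

/-- The code test is one-bit. [folklore] -/
theorem oneBit_isCanonFn : OneBit isCanonFn := fun w => ⟨_, isCanonFn_apply w⟩

/-- **Reading an item**: item `j` of the items part of `encode λ` is `1^{λ_j}` (`ε` past the end).
[folklore] -/
theorem nthItemFn_ones_body_map (l : List ℕ) (j : ℕ) :
    nthItemFn (boolPair (ones j) (body (l.map ones))) = ones (listFn l j) := by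
  rw [nthItemFn_body, List.getD_eq_getElem?_getD, List.getElem?_map, listFn, List.getD_eq_getElem?_getD]
  cases l[j]? <;> rfl

/-- A concatenation of unary blocks is the unary block of the sum. [folklore] -/
theorem ccat_ones (n : ℕ → ℕ) : ∀ k, ccat (fun j => ones (n j)) k = ones (∑ j ∈ Finset.range k, n j)
  | 0 => rfl
  | k + 1 => by
    rw [ccat_succ, ccat_ones n k, Finset.sum_range_succ]
    exact List.replicate_append_replicate ..

/-- **The code of a composition as a concatenation**: `encode λ = ⟨1^{|λ|}, ccat_i ⟨1^{λ_i}, ε⟩⟩`.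
[folklore] -/
theorem encode_eq_ccat (l : List ℕ) :
    encodingComposition.encode l =
      boolPair (ones l.length) (ccat (fun i => boolPair (ones (listFn l i)) []) l.length) := by
  rw [encode_eq_boolPair_body]
  congr 1
  have hmap : l.map ones = List.ofFn fun i : Fin l.length => ones (listFn l i) := by
    apply List.ext_getElem (by simp)
    intro i h1 h2
    rw [List.getElem_map, List.getElem_ofFn, listFn_of_lt (by simpa using h1)]
  have hbody : ∀ L : List (List Bool), body L = frames L := by
    intro L
    induction L with
    | nil => rfl
    | cons a L ih => rw [body_cons, frames_cons_eq_boolPair, ih]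
  rw [hbody, hmap, frames_ofFn (fun n => ones (listFn l n))]
  exact ccat_congr fun i _ => by rw [boolPair_eq, List.append_nil]

/-! ### Comparisons of unary numerals; the strictness flag -/

/-- `cmp s a b`: `a < b` if `s` (open cone), `a ≤ b` (as `¬ b < a`) otherwise (closed cone).
[cite: FischerIkenmeyer2020, §5 (C = {x > y > z}, C̄ = {x ≥ y ≥ z})] -/
def cmp : Bool → ℕ → ℕ → Bool
  | true, a, b => decide (a < b)
  | false, a, b => !decide (b < a)

/-- The comparison brick on a pair of unary numerals `⟨1ᵃ, 1ᵇ⟩` (`Brick.ltLenF` compares lengths).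
[cite: AroraBarak2009, §1.3] -/
def cmpF : Bool → (List Bool → List Bool)
  | true => ltLenF
  | false => notFn (ltLenF ∘ fanoutFn sndF fstF)

/-- Value of the comparison brick on a pair. [folklore] -/
theorem cmpF_boolPair (s : Bool) (u a : List Bool) : cmpF s (boolPair u a) = [cmp s u.length a.length] := by
  cases s
  · rw [cmpF, notFn_apply (b := decide (a.length < u.length))]
    · rfl
    · simp
  · rw [cmpF, ltLenF_boolPair]
    rfl

/-- The comparison brick is one-bit. [folklore] -/
theorem oneBit_cmpF (s : Bool) : OneBit (cmpF s) := by
  cases s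
  · exact oneBit_notFn (oneBit_ltLenF.comp _)
  · exact oneBit_ltLenF

/-- `cmpF s ∈ FP`. [cite: AroraBarak2009, §1.3] -/
theorem cmpF_mem_FP (s : Bool) : cmpF s ∈ FP := by
  cases s
  · exact notFn_mem_FP (comp_mem_FP ltLenF_mem_FP (fanoutFn_mem_FP sndF_mem_FP fstF_mem_FP))
  · exact ltLenF_mem_FP

/-! ### Level 3: the indicator piece `[(i,u,v) ∈ P̄] + [(u,i,v) ∈ P̄] + [(u,v,i) ∈ P̄]` in unary

Arguments are records `⟨⟨⟨X, 1ⁱ⟩, 1ᵘ⟩, 1ᵛ⟩` with the context `X = ⟨w, pad⟩`, `w = ⟨1^{r+1}, items⟩`. -/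

/-- Projection `1ᵛ`. [folklore] -/
def pV : List Bool → List Bool := sndF
/-- Projection `1ᵘ`. [folklore] -/
def pU : List Bool → List Bool := sndF ∘ fstF
/-- Projection `1ⁱ`. [folklore] -/
def pI : List Bool → List Bool := sndF ∘ fstF ∘ fstF
/-- Projection onto the header `1^{r+1}` (five first projections down). [folklore] -/
def pH3 : List Bool → List Bool := fstF ∘ fstF ∘ fstF ∘ fstF ∘ fstF
/-- `1ⁱ 1ᵘ 1ᵛ` (the coordinate sum in unary). [folklore] -/
def cat3 : List Bool → List Bool := fun z => pI z ++ pU z ++ pV z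
/-- The layer test `[i + u + v < r]`, as `|1 1ⁱ 1ᵘ 1ᵛ| < |1^{r+1}|`. [cite: FischerIkenmeyer2020, §6 (P̄_{r-1} = {x+y+z ≤ r-1} ∩ C̄)] -/
def sumT : List Bool → List Bool := ltLenF ∘ fanoutFn (List.cons true ∘ cat3) pH3

/-- `pV ∈ FP`. [folklore] -/
theorem pV_mem_FP : pV ∈ FP := sndF_mem_FP
/-- `pU ∈ FP`. [folklore] -/
theorem pU_mem_FP : pU ∈ FP := comp_mem_FP sndF_mem_FP fstF_mem_FP
/-- `pI ∈ FP`. [folklore] -/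
theorem pI_mem_FP : pI ∈ FP := comp_mem_FP sndF_mem_FP (comp_mem_FP fstF_mem_FP fstF_mem_FP)
/-- `pH3 ∈ FP`. [folklore] -/
theorem pH3_mem_FP : pH3 ∈ FP :=
  comp_mem_FP fstF_mem_FP (comp_mem_FP fstF_mem_FP (comp_mem_FP fstF_mem_FP (comp_mem_FP fstF_mem_FP fstF_mem_FP)))
/-- `cat3 ∈ FP`. [folklore] -/
theorem cat3_mem_FP : cat3 ∈ FP := append_mem_FP (append_mem_FP pI_mem_FP pU_mem_FP) pV_mem_FP
/-- `sumT ∈ FP`. [folklore] -/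
theorem sumT_mem_FP : sumT ∈ FP :=
  comp_mem_FP ltLenF_mem_FP (fanoutFn_mem_FP (comp_mem_FP (cons_mem_FP true) cat3_mem_FP) pH3_mem_FP)
/-- `sumT` is one-bit. [folklore] -/
theorem oneBit_sumT : OneBit sumT := oneBit_ltLenF.comp _

/-- Test of `(i, u, v) ∈ P̄`: `cmp u i ∧ cmp v u ∧ i+u+v < r`. [cite: FischerIkenmeyer2020, §5–§6] -/
def condX (s : Bool) : List Bool → List Bool :=
  andFn (cmpF s ∘ fanoutFn pU pI) (andFn (cmpF s ∘ fanoutFn pV pU) sumT)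
/-- Test of `(u, i, v) ∈ P̄`: `cmp i u ∧ cmp v i ∧ i+u+v < r`. [cite: FischerIkenmeyer2020, §5–§6] -/
def condY (s : Bool) : List Bool → List Bool :=
  andFn (cmpF s ∘ fanoutFn pI pU) (andFn (cmpF s ∘ fanoutFn pV pI) sumT)
/-- Test of `(u, v, i) ∈ P̄`: `cmp v u ∧ cmp i v ∧ i+u+v < r`. [cite: FischerIkenmeyer2020, §5–§6] -/
def condZ (s : Bool) : List Bool → List Bool :=
  andFn (cmpF s ∘ fanoutFn pV pU) (andFn (cmpF s ∘ fanoutFn pI pV) sumT)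

/-- `condX s ∈ FP`. [folklore] -/
theorem condX_mem_FP (s : Bool) : condX s ∈ FP :=
  andFn_mem_FP (comp_mem_FP (cmpF_mem_FP s) (fanoutFn_mem_FP pU_mem_FP pI_mem_FP))
    (andFn_mem_FP (comp_mem_FP (cmpF_mem_FP s) (fanoutFn_mem_FP pV_mem_FP pU_mem_FP)) sumT_mem_FP)
/-- `condY s ∈ FP`. [folklore] -/
theorem condY_mem_FP (s : Bool) : condY s ∈ FP :=
  andFn_mem_FP (comp_mem_FP (cmpF_mem_FP s) (fanoutFn_mem_FP pI_mem_FP pU_mem_FP))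
    (andFn_mem_FP (comp_mem_FP (cmpF_mem_FP s) (fanoutFn_mem_FP pV_mem_FP pI_mem_FP)) sumT_mem_FP)
/-- `condZ s ∈ FP`. [folklore] -/
theorem condZ_mem_FP (s : Bool) : condZ s ∈ FP :=
  andFn_mem_FP (comp_mem_FP (cmpF_mem_FP s) (fanoutFn_mem_FP pV_mem_FP pU_mem_FP))
    (andFn_mem_FP (comp_mem_FP (cmpF_mem_FP s) (fanoutFn_mem_FP pI_mem_FP pV_mem_FP)) sumT_mem_FP)
/-- `condX s` is one-bit. [folklore] -/
theorem oneBit_condX (s : Bool) : OneBit (condX s) :=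
  oneBit_andFn ((oneBit_cmpF s).comp _) (oneBit_andFn ((oneBit_cmpF s).comp _) oneBit_sumT)
/-- `condY s` is one-bit. [folklore] -/
theorem oneBit_condY (s : Bool) : OneBit (condY s) :=
  oneBit_andFn ((oneBit_cmpF s).comp _) (oneBit_andFn ((oneBit_cmpF s).comp _) oneBit_sumT)
/-- `condZ s` is one-bit. [folklore] -/
theorem oneBit_condZ (s : Bool) : OneBit (condZ s) :=
  oneBit_andFn ((oneBit_cmpF s).comp _) (oneBit_andFn ((oneBit_cmpF s).comp _) oneBit_sumT)

/-- A bit in unary: `oneIf c z = 1^{[c z]}`. [folklore] -/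
def oneIf (c : List Bool → List Bool) : List Bool → List Bool := iteFn c (fun _ => [true]) (fun _ => [])

/-- `oneIf c ∈ FP` for `c ∈ FP`. [folklore] -/
theorem oneIf_mem_FP {c : List Bool → List Bool} (hc : c ∈ FP) : oneIf c ∈ FP :=
  iteFn_mem_FP hc (const_mem_FP _) (const_mem_FP _)

/-- Value of `oneIf`: `1^{b}` when `c z = [b]`. [folklore] -/
theorem oneIf_apply {c : List Bool → List Bool} {z : List Bool} {b : Bool} (h : c z = [b]) :
    oneIf c z = ones b.toNat := by
  rw [oneIf, iteFn_apply h]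
  cases b <;> rfl

/-- `oneIf` of a one-bit condition has length `≤ 1`. [folklore] -/
theorem length_oneIf_le {c : List Bool → List Bool} (hc : OneBit c) (z : List Bool) : (oneIf c z).length ≤ 1 := by
  obtain ⟨b, hb⟩ := hc z
  rw [oneIf_apply hb]
  cases b <;> simp

/-- **The level-3 piece** `gF s ⟨⟨⟨X, 1ⁱ⟩, 1ᵘ⟩, 1ᵛ⟩ = 1^{[(i,u,v) ∈ P̄] + [(u,i,v) ∈ P̄] + [(u,v,i) ∈ P̄]}`.
[cite: FischerIkenmeyer2020, Lemma 7 (λ := S(P̄_{r-1}) + λ̂)] -/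
def gF (s : Bool) : List Bool → List Bool := fun z => oneIf (condX s) z ++ oneIf (condY s) z ++ oneIf (condZ s) z

/-- `gF s ∈ FP`. [cite: AroraBarak2009, §1.3] -/
theorem gF_mem_FP (s : Bool) : gF s ∈ FP :=
  append_mem_FP (append_mem_FP (oneIf_mem_FP (condX_mem_FP s)) (oneIf_mem_FP (condY_mem_FP s)))
    (oneIf_mem_FP (condZ_mem_FP s))

/-- **`gF` is short on every input**: `|gF s z| ≤ 3 ≤ 3(|fstF z| + 1)`. [folklore] -/
theorem length_gF_le (s : Bool) (z : List Bool) : (gF s z).length ≤ 3 * ((fstF z).length + 1) := by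
  have h1 := length_oneIf_le (oneBit_condX s) z
  have h2 := length_oneIf_le (oneBit_condY s) z
  have h3 := length_oneIf_le (oneBit_condZ s) z
  simp only [gF, List.length_append]
  nlinarith

/-- The three indicator bits at `(i, u, v)` for header length `L = r + 1`: `[(i,u,v) ∈ P̄]`. [folklore] -/
def bX (s : Bool) (L i u v : ℕ) : Bool := cmp s u i && (cmp s v u && decide (i + u + v + 1 < L))
/-- `[(u,i,v) ∈ P̄]`. [folklore] -/
def bY (s : Bool) (L i u v : ℕ) : Bool := cmp s i u && (cmp s v i && decide (i + u + v + 1 < L))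
/-- `[(u,v,i) ∈ P̄]`. [folklore] -/
def bZ (s : Bool) (L i u v : ℕ) : Bool := cmp s v u && (cmp s i v && decide (i + u + v + 1 < L))
/-- The level-3 count `c3 = [(i,u,v) ∈ P̄] + [(u,i,v) ∈ P̄] + [(u,v,i) ∈ P̄] ≤ 3`. [folklore] -/
def c3 (s : Bool) (L i u v : ℕ) : ℕ := (bX s L i u v).toNat + (bY s L i u v).toNat + (bZ s L i u v).toNat

/-- `c3 ≤ 3`. [folklore] -/
theorem c3_le (s : Bool) (L i u v : ℕ) : c3 s L i u v ≤ 3 := by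
  unfold c3
  have := Bool.toNat_le (bX s L i u v)
  have := Bool.toNat_le (bY s L i u v)
  have := Bool.toNat_le (bZ s L i u v)
  omega

section Records

variable (X H B pad : List Bool) (i u v : ℕ)

/-- The level-3 record `⟨⟨⟨⟨⟨H, B⟩, pad⟩, 1ⁱ⟩, 1ᵘ⟩, 1ᵛ⟩`. [folklore] -/
def rec3 : List Bool :=
  boolPair (boolPair (boolPair (boolPair (boolPair H B) pad) (ones i)) (ones u)) (ones v)

/-- `pV` on the record. [folklore] -/
@[simp] theorem pV_rec3 : pV (rec3 H B pad i u v) = ones v := by simp [pV, rec3]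
/-- `pU` on the record. [folklore] -/
@[simp] theorem pU_rec3 : pU (rec3 H B pad i u v) = ones u := by simp [pU, rec3]
/-- `pI` on the record. [folklore] -/
@[simp] theorem pI_rec3 : pI (rec3 H B pad i u v) = ones i := by simp [pI, rec3]
/-- `pH3` on the record. [folklore] -/
@[simp] theorem pH3_rec3 : pH3 (rec3 H B pad i u v) = H := by simp [pH3, rec3]

/-- The layer test on the record. [folklore] -/
theorem sumT_rec3 : sumT (rec3 H B pad i u v) = [decide (i + u + v + 1 < H.length)] := by
  simp only [sumT, Function.comp_apply, fanoutFn_apply, ltLenF_boolPair, cat3, pI_rec3, pU_rec3, pV_rec3,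
    pH3_rec3, List.length_cons, List.length_append, List.length_replicate]

/-- `condX` on the record. [folklore] -/
theorem condX_rec3 (s : Bool) : condX s (rec3 H B pad i u v) = [bX s H.length i u v] := by
  rw [condX, andFn_apply (b := cmp s u i) (b' := cmp s v u && decide (i + u + v + 1 < H.length))]
  · rfl
  · rw [Function.comp_apply, fanoutFn_apply, cmpF_boolPair, pU_rec3, pI_rec3, List.length_replicate,
      List.length_replicate]
  · rw [andFn_apply (b := cmp s v u) (b' := decide (i + u + v + 1 < H.length))]
    · rw [Function.comp_apply, fanoutFn_apply, cmpF_boolPair, pV_rec3, pU_rec3, List.length_replicate,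
        List.length_replicate]
    · exact sumT_rec3 H B pad i u v

/-- `condY` on the record. [folklore] -/
theorem condY_rec3 (s : Bool) : condY s (rec3 H B pad i u v) = [bY s H.length i u v] := by
  rw [condY, andFn_apply (b := cmp s i u) (b' := cmp s v i && decide (i + u + v + 1 < H.length))]
  · rfl
  · rw [Function.comp_apply, fanoutFn_apply, cmpF_boolPair, pI_rec3, pU_rec3, List.length_replicate,
      List.length_replicate]
  · rw [andFn_apply (b := cmp s v i) (b' := decide (i + u + v + 1 < H.length))]
    · rw [Function.comp_apply, fanoutFn_apply, cmpF_boolPair, pV_rec3, pI_rec3, List.length_replicate,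
        List.length_replicate]
    · exact sumT_rec3 H B pad i u v

/-- `condZ` on the record. [folklore] -/
theorem condZ_rec3 (s : Bool) : condZ s (rec3 H B pad i u v) = [bZ s H.length i u v] := by
  rw [condZ, andFn_apply (b := cmp s v u) (b' := cmp s i v && decide (i + u + v + 1 < H.length))]
  · rfl
  · rw [Function.comp_apply, fanoutFn_apply, cmpF_boolPair, pV_rec3, pU_rec3, List.length_replicate,
      List.length_replicate]
  · rw [andFn_apply (b := cmp s i v) (b' := decide (i + u + v + 1 < H.length))]
    · rw [Function.comp_apply, fanoutFn_apply, cmpF_boolPair, pI_rec3, pV_rec3, List.length_replicate,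
        List.length_replicate]
    · exact sumT_rec3 H B pad i u v

/-- **Value of the level-3 piece on the record**: `1^{c3}`. [folklore] -/
theorem gF_rec3 (s : Bool) : gF s (rec3 H B pad i u v) = ones (c3 s H.length i u v) := by
  rw [gF, oneIf_apply (condX_rec3 H B pad i u v s), oneIf_apply (condY_rec3 H B pad i u v s),
    oneIf_apply (condZ_rec3 H B pad i u v s), c3, List.replicate_append_replicate,
    List.replicate_append_replicate]

end Records

/-! ### Levels 2 and 1: the sum-marginal `S_i(P̄_{r-1})` in unary by two concatenation folds -/

/-- The fold initialiser `z ↦ ⟨z, ⟨⌜|hdr z|⌝, ⟨1⁰, ε⟩⟩⟩` (countdown = header length = `r + 1` rounds,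
unary index `0`, empty accumulator). [cite: AroraBarak2009, §1.3 (bounded loops)] -/
def initF (hdr : List Bool → List Bool) : List Bool → List Bool :=
  fanoutFn id (fanoutFn (lenBinF ∘ hdr) (fun _ => boolPair [] []))

/-- `initF hdr ∈ FP` for `hdr ∈ FP`. [folklore] -/
theorem initF_mem_FP {hdr : List Bool → List Bool} (h : hdr ∈ FP) : initF hdr ∈ FP :=
  fanoutFn_mem_FP id_mem_FP (fanoutFn_mem_FP (comp_mem_FP lenBinF_mem_FP h) (const_mem_FP _))

/-- Value of `initF`. [folklore] -/
theorem initF_apply (hdr : List Bool → List Bool) (z : List Bool) :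
    initF hdr z = boolPair z (boolPair (encodeNat (hdr z).length) (boolPair (ones 0) [])) := by
  simp [initF]

/-- Header projection at level 2 (`⟨⟨X, 1ⁱ⟩, 1ᵘ⟩ ↦ 1^{r+1}`). [folklore] -/
def pH2 : List Bool → List Bool := fstF ∘ fstF ∘ fstF ∘ fstF
/-- `pH2 ∈ FP`. [folklore] -/
theorem pH2_mem_FP : pH2 ∈ FP :=
  comp_mem_FP fstF_mem_FP (comp_mem_FP fstF_mem_FP (comp_mem_FP fstF_mem_FP fstF_mem_FP))

/-- **Level 2**: `MF s ⟨⟨X, 1ⁱ⟩, 1ᵘ⟩ = 1^{Σ_{v ≤ r} c3(i,u,v)}` (a concatenation fold of `gF s` over `v`).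
[cite: AroraBarak2009, §1.3 (bounded loops)] -/
def MF (s : Bool) : List Bool → List Bool := sndPow 2 ∘ foldLoop appF (gF s) X ∘ initF pH2

/-- `MF s ∈ FP`. [cite: AroraBarak2009, §1.3] -/
theorem MF_mem_FP (s : Bool) : MF s ∈ FP :=
  comp_mem_FP (sndPow_mem_FP 2) (comp_mem_FP
    (foldLoop_mem_FP appF_mem_FP length_appF_le (gF_mem_FP s) (length_gF_le s) X) (initF_mem_FP pH2_mem_FP))

/-- Header projection at level 1 (`⟨X, 1ⁱ⟩ ↦ 1^{r+1}`). [folklore] -/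
def pH1 : List Bool → List Bool := fstF ∘ fstF ∘ fstF
/-- `pH1 ∈ FP`. [folklore] -/
theorem pH1_mem_FP : pH1 ∈ FP := comp_mem_FP fstF_mem_FP (comp_mem_FP fstF_mem_FP fstF_mem_FP)

/-- **Level 1**: `SF s ⟨X, 1ⁱ⟩ = 1^{Σ_{u ≤ r} Σ_{v ≤ r} c3(i,u,v)} = 1^{S_i(P̄_{r-1})}` (a concatenation fold
of the clipped `MF s` over `u`). [cite: AroraBarak2009, §1.3 (bounded loops)] -/
def SF (s : Bool) : List Bool → List Bool := sndPow 2 ∘ foldLoop appF (clipF 3 (MF s)) X ∘ initF pH1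

/-- `SF s ∈ FP`. [cite: AroraBarak2009, §1.3] -/
theorem SF_mem_FP (s : Bool) : SF s ∈ FP :=
  comp_mem_FP (sndPow_mem_FP 2) (comp_mem_FP
    (foldLoop_clipF_mem_FP 3 appF_mem_FP length_appF_le (MF_mem_FP s) X) (initF_mem_FP pH1_mem_FP))

/-! ### Level 0: the output code, piece by piece -/

/-- Item `i` of the input, read from `⟨⟨w, pad⟩, 1ⁱ⟩` (`HashBricks.nthItemFn ⟨1ⁱ, items⟩`). [folklore] -/
def itemX : List Bool → List Bool := nthItemFn ∘ fanoutFn sndF (sndF ∘ fstF ∘ fstF)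
/-- `itemX ∈ FP`. [folklore] -/
theorem itemX_mem_FP : itemX ∈ FP :=
  comp_mem_FP nthItemFn_mem_FP (fanoutFn_mem_FP sndF_mem_FP (comp_mem_FP sndF_mem_FP (comp_mem_FP fstF_mem_FP fstF_mem_FP)))

/-- **The output piece** `⟨1^{S_i + λ̂_i}, ε⟩` (`= 1^{2(S_i+λ̂_i)} 0 1`, item `i` of the output code).
[cite: FischerIkenmeyer2020, Lemma 7 (λ := S(P̄_{r-1}) + λ̂)] -/
def pieceF (s : Bool) : List Bool → List Bool := fanoutFn (fun z => SF s z ++ itemX z) (fun _ => [])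
/-- `pieceF s ∈ FP`. [folklore] -/
theorem pieceF_mem_FP (s : Bool) : pieceF s ∈ FP :=
  fanoutFn_mem_FP (append_mem_FP (SF_mem_FP s) itemX_mem_FP) (const_mem_FP _)

/-- The context `X = ⟨w, 1^{|w|²}⟩`: the input and a quadratic pad (the yardstick making every output
piece linearly bounded in the loop's first field). [cite: AroraBarak2009, §1.3] -/
def ctxF : List Bool → List Bool := fanoutFn id (polyFn (X ^ 2))
/-- `ctxF ∈ FP`. [folklore] -/
theorem ctxF_mem_FP : ctxF ∈ FP := fanoutFn_mem_FP id_mem_FP (polyFn_mem_FP _)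

/-- The level-0 initial record `⟨X, ⟨⌜r+1⌝, ⟨1⁰, ε⟩⟩⟩`. [folklore] -/
def init0 : List Bool → List Bool := fanoutFn ctxF (fanoutFn (lenBinF ∘ fstF) (fun _ => boolPair [] []))
/-- `init0 ∈ FP`. [folklore] -/
theorem init0_mem_FP : init0 ∈ FP :=
  fanoutFn_mem_FP ctxF_mem_FP (fanoutFn_mem_FP (comp_mem_FP lenBinF_mem_FP fstF_mem_FP) (const_mem_FP _))

/-- **The core of the reduction**: header kept, items `⟨1^{S_i + λ̂_i}, ε⟩` concatenated for
`i = 0, …, r` — the code of `λ := S(P̄_{r-1}) + λ̂`. [cite: FischerIkenmeyer2020, Lemma 5 (proof) and Lemma 7] -/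
def coreF (s : Bool) : List Bool → List Bool :=
  fanoutFn fstF (sndPow 2 ∘ foldLoop appF (clipF 6 (pieceF s)) X ∘ init0)
/-- `coreF s ∈ FP`. [cite: AroraBarak2009, §1.3] -/
theorem coreF_mem_FP (s : Bool) : coreF s ∈ FP :=
  fanoutFn_mem_FP fstF_mem_FP (comp_mem_FP (sndPow_mem_FP 2)
    (comp_mem_FP (foldLoop_clipF_mem_FP 6 appF_mem_FP length_appF_le (pieceF_mem_FP s) X) init0_mem_FP))

/-! ### Values on genuine codes -/

section Values

variable (s : Bool) (l : List ℕ)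

/-- The code `w = encode λ̂`. [folklore] -/
def wOf : List Bool := encodingComposition.encode l
/-- The context `X = ⟨w, 1^{|w|²}⟩`. [folklore] -/
def xOf : List Bool := boolPair (wOf l) (ones ((wOf l).length ^ 2))

/-- `ctxF w = X`. [folklore] -/
theorem ctxF_wOf : ctxF (wOf l) = xOf l := by simp [ctxF, xOf]

/-- The header is not longer than the code: `r + 1 ≤ |w|`. [folklore] -/
theorem length_le_length_wOf : l.length ≤ (wOf l).length := by
  rw [wOf, length_encode]; omega

/-- `|λ̂| ≤ |w|`. [folklore] -/
theorem sum_le_length_wOf : l.sum ≤ (wOf l).length := by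
  rw [wOf, length_encode]; omega

/-- `|X| = 2|w| + 2 + |w|²`. [folklore] -/
theorem length_xOf : (xOf l).length = 2 * (wOf l).length + 2 + (wOf l).length ^ 2 := by
  rw [xOf, length_boolPair, List.length_replicate]

/-- The level-1/2/3 records over the genuine context are `rec3`. [folklore] -/
theorem rec3_eq (i u v : ℕ) : boolPair (boolPair (boolPair (xOf l) (ones i)) (ones u)) (ones v) =
    rec3 (ones l.length) (body (l.map ones)) (ones ((wOf l).length ^ 2)) i u v := by
  rw [rec3, xOf, wOf, encode_eq_boolPair_body]

/-- **Value of level 2**: `MF s ⟨⟨X, 1ⁱ⟩, 1ᵘ⟩ = 1^{Σ_{v<L} c3}`. [folklore] -/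
theorem MF_apply (i u : ℕ) : MF s (boolPair (boolPair (xOf l) (ones i)) (ones u)) =
    ones (∑ v ∈ Finset.range l.length, c3 s l.length i u v) := by
  have hH : pH2 (boolPair (boolPair (xOf l) (ones i)) (ones u)) = ones l.length := by
    simp [pH2, xOf, wOf, encode_eq_boolPair_body]
  have hk : l.length ≤ (X : Polynomial ℕ).eval (boolPair (boolPair (xOf l) (ones i)) (ones u)).length := by
    rw [eval_X, length_boolPair, length_boolPair]
    have := length_le_length_wOf l
    have : (wOf l).length ≤ (xOf l).length := by rw [length_xOf]; omega
    omega
  rw [MF, Function.comp_apply, Function.comp_apply, initF_apply, hH, List.length_replicate,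
    foldLoop_apply _ _ hk, sndPow_succ_boolPair, sndPow_succ_boolPair, sndPow_zero_boolPair, foldAcc_appF,
    List.nil_append, ← ccat_ones]
  refine ccat_congr fun v _ => ?_
  rw [Nat.zero_add, rec3_eq, gF_rec3, List.length_replicate]

/-- **Value of level 1**: `SF s ⟨X, 1ⁱ⟩ = 1^{Σ_{u<L} Σ_{v<L} c3}`. [folklore] -/
theorem SF_apply (i : ℕ) : SF s (boolPair (xOf l) (ones i)) =
    ones (∑ u ∈ Finset.range l.length, ∑ v ∈ Finset.range l.length, c3 s l.length i u v) := by
  have hH : pH1 (boolPair (xOf l) (ones i)) = ones l.length := by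
    simp [pH1, xOf, wOf, encode_eq_boolPair_body]
  have hwx : (wOf l).length ≤ (xOf l).length := by rw [length_xOf]; omega
  have hk : l.length ≤ (X : Polynomial ℕ).eval (boolPair (xOf l) (ones i)).length := by
    rw [eval_X, length_boolPair]
    have := length_le_length_wOf l
    omega
  rw [SF, Function.comp_apply, Function.comp_apply, initF_apply, hH, List.length_replicate,
    foldLoop_apply _ _ hk, sndPow_succ_boolPair, sndPow_succ_boolPair, sndPow_zero_boolPair,
    foldAcc_clipF, foldAcc_appF, List.nil_append, ← ccat_ones]
  · refine ccat_congr fun u _ => ?_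
    rw [Nat.zero_add, MF_apply]
  · intro u _ _
    rw [MF_apply, List.length_replicate, length_boolPair, List.length_replicate]
    have hsum : ∑ v ∈ Finset.range l.length, c3 s l.length i u v ≤ ∑ _v ∈ Finset.range l.length, 3 :=
      Finset.sum_le_sum fun v _ => c3_le s l.length i u v
    rw [Finset.sum_const, Finset.card_range, smul_eq_mul] at hsum
    have := length_le_length_wOf l
    nlinarith [hwx]

/-- Item `i` read through the context: `itemX ⟨X, 1ⁱ⟩ = 1^{λ̂_i}`. [folklore] -/
theorem itemX_apply (i : ℕ) : itemX (boolPair (xOf l) (ones i)) = ones (listFn l i) := by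
  simp only [itemX, Function.comp_apply, fanoutFn_apply, sndF_boolPair, fstF_boolPair, xOf, wOf,
    encode_eq_boolPair_body]
  exact nthItemFn_ones_body_map l i

/-- **The machine's `S_i`**: the double indicator sum `Σ_{u<L} Σ_{v<L} c3(i,u,v)` (`L = r + 1`).
[cite: FischerIkenmeyer2020, Lemma 7 (S(P̄_{r-1}))] -/
def sMach (i : ℕ) : ℕ := ∑ u ∈ Finset.range l.length, ∑ v ∈ Finset.range l.length, c3 s l.length i u v

/-- `S_i ≤ 3 L²`. [folklore] -/
theorem sMach_le (i : ℕ) : sMach s l i ≤ 3 * l.length ^ 2 := by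
  unfold sMach
  calc ∑ u ∈ Finset.range l.length, ∑ v ∈ Finset.range l.length, c3 s l.length i u v
      ≤ ∑ _u ∈ Finset.range l.length, ∑ _v ∈ Finset.range l.length, 3 :=
        Finset.sum_le_sum fun u _ => Finset.sum_le_sum fun v _ => c3_le s l.length i u v
    _ = 3 * l.length ^ 2 := by
        rw [Finset.sum_const, Finset.card_range, smul_eq_mul, Finset.sum_const, Finset.card_range, smul_eq_mul]
        ring

/-- **Value of the output piece**: `pieceF s ⟨X, 1ⁱ⟩ = ⟨1^{S_i + λ̂_i}, ε⟩`. [folklore] -/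
theorem pieceF_apply (i : ℕ) :
    pieceF s (boolPair (xOf l) (ones i)) = boolPair (ones (sMach s l i + listFn l i)) [] := by
  rw [pieceF, fanoutFn_apply, SF_apply, itemX_apply, sMach, List.replicate_append_replicate]

/-- **The output pieces are linearly bounded in the context** (thanks to the quadratic pad):
`|pieceF s ⟨X, 1ⁱ⟩| ≤ 6(|X| + 1)`. [folklore] -/
theorem length_pieceF_apply_le (i : ℕ) :
    (pieceF s (boolPair (xOf l) (ones i))).length ≤ 6 * ((xOf l).length + 1) := by
  rw [pieceF_apply, length_boolPair, List.length_replicate, List.length_nil, length_xOf]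
  have h1 := sMach_le s l i
  have h2 := listFn_le_sum l i
  have h3 := length_le_length_wOf l
  have h4 := sum_le_length_wOf l
  have h5 : l.length ^ 2 ≤ (wOf l).length ^ 2 := Nat.pow_le_pow_left h3 2
  nlinarith

/-- The level-0 initial record on a code. [folklore] -/
theorem init0_wOf : init0 (wOf l) = boolPair (xOf l) (boolPair (encodeNat l.length) (boolPair (ones 0) [])) := by
  have hfst : fstF (wOf l) = ones l.length := by rw [wOf, encode_eq_boolPair_body, fstF_boolPair]
  simp only [init0, fanoutFn_apply, ctxF_wOf, Function.comp_apply, hfst, lenBinF_apply, List.length_replicate]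
  rfl

/-- **Value of the core on a code**: header, then the pieces `⟨1^{S_i + λ̂_i}, ε⟩`, `i = 0, …, r`.
[cite: FischerIkenmeyer2020, Lemma 5 (proof)] -/
theorem coreF_wOf : coreF s (wOf l) =
    boolPair (ones l.length) (ccat (fun i => boolPair (ones (sMach s l i + listFn l i)) []) l.length) := by
  have hfst : fstF (wOf l) = ones l.length := by rw [wOf, encode_eq_boolPair_body, fstF_boolPair]
  have hk : l.length ≤ (X : Polynomial ℕ).eval (xOf l).length := by
    rw [eval_X, length_xOf]
    have := length_le_length_wOf l
    omega
  rw [coreF, fanoutFn_apply, hfst, Function.comp_apply, Function.comp_apply, init0_wOf, foldLoop_apply _ _ hk,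
    sndPow_succ_boolPair, sndPow_succ_boolPair, sndPow_zero_boolPair, foldAcc_clipF, foldAcc_appF,
    List.nil_append]
  · exact congrArg _ (ccat_congr fun i _ => by rw [Nat.zero_add, pieceF_apply])
  · intro i _ _
    exact length_pieceF_apply_le s l i

/-- `[P] = b` as natural numbers when `P ↔ b`. [folklore] -/
theorem ite_eq_toNat (P : Prop) [Decidable P] (b : Bool) (h : P ↔ b = true) : (if P then 1 else 0) = b.toNat := by
  by_cases hp : P
  · rw [if_pos hp, h.1 hp]
    rfl
  · have hb : b = false := by
      cases b
      · rfl
      · exact absurd (h.2 rfl) hp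
    rw [if_neg hp, hb]
    rfl

/-- **The machine's `S_i` is `S_i(P̄_{r-1})`** for every region `K` cut out by the comparisons of the
flag `s` (`K = C̄` for `s = false`, `K = C` for `s = true`). [cite: FischerIkenmeyer2020, Lemma 7] -/
theorem sMach_eq_sumMarginal {K : Point → Prop} [DecidablePred K]
    (hK : ∀ a b c : ℕ, K (a, b, c) ↔ (cmp s b a = true ∧ cmp s c b = true)) (i : ℕ) :
    sMach s l i = sumMarginal (pyrBelow K (l.length - 1)) i := by
  rw [sMach, sumMarginal_pyrBelow_eq_sum_sum (K := K) (r := l.length - 1) (L := l.length) (Nat.sub_le _ _) i]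
  refine Finset.sum_congr rfl fun u _ => Finset.sum_congr rfl fun v _ => ?_
  rw [c3, ite_eq_toNat _ (bX s l.length i u v), ite_eq_toNat _ (bY s l.length i u v),
    ite_eq_toNat _ (bZ s l.length i u v)]
  · rw [mem_pyrBelow, hK, bZ, Bool.and_eq_true, Bool.and_eq_true, decide_eq_true_iff]
    simp only [coordSum]
    exact ⟨fun ⟨⟨h1, h2⟩, h3⟩ => ⟨h1, h2, by omega⟩, fun ⟨h1, h2, h3⟩ => ⟨⟨h1, h2⟩, by omega⟩⟩
  · rw [mem_pyrBelow, hK, bY, Bool.and_eq_true, Bool.and_eq_true, decide_eq_true_iff]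
    simp only [coordSum]
    exact ⟨fun ⟨⟨h1, h2⟩, h3⟩ => ⟨h1, h2, by omega⟩, fun ⟨h1, h2, h3⟩ => ⟨⟨h1, h2⟩, by omega⟩⟩
  · rw [mem_pyrBelow, hK, bX, Bool.and_eq_true, Bool.and_eq_true, decide_eq_true_iff]
    simp only [coordSum]
    exact ⟨fun ⟨⟨h1, h2⟩, h3⟩ => ⟨h1, h2, by omega⟩, fun ⟨h1, h2, h3⟩ => ⟨⟨h1, h2⟩, by omega⟩⟩

/-- **The core computes the code of `λ := S(P̄_{r-1}) + λ̂`**: `coreF s (encode λ̂) = encode (addPyr K λ̂)`.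
[cite: FischerIkenmeyer2020, Lemma 5 (proof: "construct λ := S(P̄_{r-1}) + λ̂ and output λ")] -/
theorem coreF_encode {K : Point → Prop} [DecidablePred K]
    (hK : ∀ a b c : ℕ, K (a, b, c) ↔ (cmp s b a = true ∧ cmp s c b = true)) :
    coreF s (encodingComposition.encode l) = encodingComposition.encode (addPyr K l) := by
  rw [encode_eq_ccat (addPyr K l), length_addPyr]
  show coreF s (wOf l) = _
  rw [coreF_wOf]
  exact congrArg _ (ccat_congr fun i _ => by rw [listFn_addPyr, sMach_eq_sumMarginal s l hK])

/-! ### The arithmetic test `[Good λ̂]` on codes -/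

/-- Item `j` of the input, read from `⟨w, 1ʲ⟩`. [folklore] -/
def itemW : List Bool → List Bool := nthItemFn ∘ fanoutFn sndF (sndF ∘ fstF)
/-- `itemW ∈ FP`. [folklore] -/
theorem itemW_mem_FP : itemW ∈ FP :=
  comp_mem_FP nthItemFn_mem_FP (fanoutFn_mem_FP sndF_mem_FP (comp_mem_FP sndF_mem_FP fstF_mem_FP))
/-- `itemW ⟨w, 1ʲ⟩ = 1^{λ̂_j}`. [folklore] -/
theorem itemW_apply (j : ℕ) : itemW (boolPair (wOf l) (ones j)) = ones (listFn l j) := by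
  simp only [itemW, Function.comp_apply, fanoutFn_apply, sndF_boolPair, fstF_boolPair, wOf, encode_eq_boolPair_body]
  exact nthItemFn_ones_body_map l j

/-- The sum fold from the empty accumulator (`ε = ⌜0⌝`). [folklore] -/
theorem foldAcc_addFn_nil (f : List Bool → List Bool) (x : List Bool) (k i : ℕ) :
    foldAcc addFn f x i k [] = encodeNat (∑ j ∈ Finset.range k, bitsToNat (f (boolPair x (ones (i + j))))) := by
  have h := foldAcc_addFn f x k i 0
  rw [Nat.zero_add] at h
  exact h

/-- **`|λ̂|` in binary**: the sum fold of the binary lengths of the items. [cite: AroraBarak2009, §1.3] -/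
def totF : List Bool → List Bool := sndPow 2 ∘ foldLoop addFn (clipF 1 (lenBinF ∘ itemW)) X ∘ initF fstF
/-- `totF ∈ FP`. [folklore] -/
theorem totF_mem_FP : totF ∈ FP :=
  comp_mem_FP (sndPow_mem_FP 2) (comp_mem_FP
    (foldLoop_clipF_mem_FP 1 addFn_mem_FP length_addFn_le (comp_mem_FP lenBinF_mem_FP itemW_mem_FP) X)
    (initF_mem_FP fstF_mem_FP))

/-- **`B(λ̂) = Σ_i i·λ̂_i` in binary**: the sum fold of the products `⌜i⌝ · ⌜λ̂_i⌝`.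
[cite: FischerIkenmeyer2020, §5 (B(λ) = Σ i λ_i)] -/
def bsumF : List Bool → List Bool :=
  sndPow 2 ∘ foldLoop addFn (clipF 1 (prodFn ∘ fanoutFn (lenBinF ∘ sndF) (lenBinF ∘ itemW))) X ∘ initF fstF
/-- `bsumF ∈ FP`. [folklore] -/
theorem bsumF_mem_FP : bsumF ∈ FP :=
  comp_mem_FP (sndPow_mem_FP 2) (comp_mem_FP
    (foldLoop_clipF_mem_FP 1 addFn_mem_FP length_addFn_le
      (comp_mem_FP prodFn_mem_FP (fanoutFn_mem_FP (comp_mem_FP lenBinF_mem_FP sndF_mem_FP)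
        (comp_mem_FP lenBinF_mem_FP itemW_mem_FP))) X)
    (initF_mem_FP fstF_mem_FP))

/-- The header of a code. [folklore] -/
theorem fstF_wOf : fstF (wOf l) = ones l.length := by rw [wOf, encode_eq_boolPair_body, fstF_boolPair]

/-- The test folds start from `⟨w, ⟨⌜r+1⌝, ⟨1⁰, ε⟩⟩⟩`. [folklore] -/
theorem initF_fstF_wOf : initF fstF (wOf l) = boolPair (wOf l) (boolPair (encodeNat l.length) (boolPair (ones 0) [])) := by
  rw [initF_apply, fstF_wOf, List.length_replicate]

/-- **Value of `totF` on a code**: `⌜|λ̂|⌝`. [folklore] -/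
theorem totF_wOf : totF (wOf l) = encodeNat l.sum := by
  have hk : l.length ≤ (X : Polynomial ℕ).eval (wOf l).length := by rw [eval_X]; exact length_le_length_wOf l
  rw [totF, Function.comp_apply, Function.comp_apply, initF_fstF_wOf, foldLoop_apply _ _ hk,
    sndPow_succ_boolPair, sndPow_succ_boolPair, sndPow_zero_boolPair, foldAcc_clipF, foldAcc_addFn_nil,
    sum_eq_sum_range_listFn]
  · exact congrArg _ (Finset.sum_congr rfl fun j _ => by
      rw [Nat.zero_add, Function.comp_apply, itemW_apply, lenBinF_apply, List.length_replicate, bitsToNat_encodeNat])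
  · intro j _ _
    rw [Function.comp_apply, itemW_apply, lenBinF_apply, List.length_replicate]
    have := TM2Pass.length_encodeNat_le_self (listFn l j)
    have := listFn_le_sum l j
    have := sum_le_length_wOf l
    omega

/-- **Value of `bsumF` on a code**: `⌜B(λ̂)⌝`. [folklore] -/
theorem bsumF_wOf : bsumF (wOf l) = encodeNat (coordSumList l) := by
  have hk : l.length ≤ (X : Polynomial ℕ).eval (wOf l).length := by rw [eval_X]; exact length_le_length_wOf l
  rw [bsumF, Function.comp_apply, Function.comp_apply, initF_fstF_wOf, foldLoop_apply _ _ hk,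
    sndPow_succ_boolPair, sndPow_succ_boolPair, sndPow_zero_boolPair, foldAcc_clipF, foldAcc_addFn_nil, coordSumList]
  · exact congrArg _ (Finset.sum_congr rfl fun j _ => by
      rw [Nat.zero_add, Function.comp_apply, fanoutFn_apply, Function.comp_apply, Function.comp_apply,
        sndF_boolPair, itemW_apply, lenBinF_apply, lenBinF_apply, List.length_replicate, List.length_replicate,
        prodFn_boolPair, bitsToNat_encodeNat, bitsToNat_encodeNat, bitsToNat_encodeNat])
  · intro j _ hj
    rw [Function.comp_apply, fanoutFn_apply, Function.comp_apply, Function.comp_apply, sndF_boolPair,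
      itemW_apply, lenBinF_apply, lenBinF_apply, List.length_replicate, List.length_replicate, prodFn_boolPair]
    have hm := Brick.length_encodeNat_mul_le (encodeNat j) (encodeNat (listFn l j))
    have h1 := TM2Pass.length_encodeNat_le_self j
    have h2 := TM2Pass.length_encodeNat_le_self (listFn l j)
    have h3 := listFn_le_sum l j
    have h4 : (wOf l).length = 4 * l.length + 2 * l.sum + 2 := length_encode l
    omega

/-- **The test of the printed proof** on codes, one bit: header nonempty, `|λ̂| ≡ 0 (mod 3)`, and
`3·B(λ̂) = r·|λ̂|` (i.e. `B(λ̂) = rn` for `n = |λ̂|/3`). [cite: FischerIkenmeyer2020, Lemma 5 (proof)] -/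
def testFn : List Bool → List Bool :=
  andFn (notFn (isNilFn ∘ fstF))
    (andFn (eqValFn ∘ fanoutFn (remFn ∘ fanoutFn totF (fun _ => encodeNat 3)) (fun _ => []))
      (eqValFn ∘ fanoutFn (prodFn ∘ fanoutFn (fun _ => encodeNat 3) bsumF)
        (prodFn ∘ fanoutFn (subFn ∘ fanoutFn (lenBinF ∘ fstF) (fun _ => [true])) totF)))

/-- `testFn ∈ FP`. [cite: AroraBarak2009, §1.3] -/
theorem testFn_mem_FP : testFn ∈ FP :=
  andFn_mem_FP (notFn_mem_FP (comp_mem_FP isNilFn_mem_FP fstF_mem_FP))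
    (andFn_mem_FP
      (comp_mem_FP eqValFn_mem_FP (fanoutFn_mem_FP
        (comp_mem_FP remFn_mem_FP (fanoutFn_mem_FP totF_mem_FP (const_mem_FP _))) (const_mem_FP _)))
      (comp_mem_FP eqValFn_mem_FP (fanoutFn_mem_FP
        (comp_mem_FP prodFn_mem_FP (fanoutFn_mem_FP (const_mem_FP _) bsumF_mem_FP))
        (comp_mem_FP prodFn_mem_FP (fanoutFn_mem_FP
          (comp_mem_FP subFn_mem_FP (fanoutFn_mem_FP (comp_mem_FP lenBinF_mem_FP fstF_mem_FP) (const_mem_FP _)))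
          totF_mem_FP)))))

/-- `testFn` is one-bit. [folklore] -/
theorem oneBit_testFn : OneBit testFn :=
  oneBit_andFn (oneBit_notFn (oneBit_isNilFn.comp _))
    (oneBit_andFn (oneBit_eqValFn.comp _) (oneBit_eqValFn.comp _))

/-- **Value of the test on a code**: `testFn (encode λ̂) = [Good λ̂]`. [cite: FischerIkenmeyer2020, Lemma 5 (proof)] -/
theorem testFn_wOf : testFn (wOf l) = [decide (Good l)] := by
  have h1 : (notFn (isNilFn ∘ fstF)) (wOf l) = [!decide (l.length = 0)] := by
    rw [notFn_apply (b := decide (l.length = 0))]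
    simp only [Function.comp_apply, fstF_wOf, isNilFn, List.replicate_eq_nil_iff]
  have h2 : (eqValFn ∘ fanoutFn (remFn ∘ fanoutFn totF (fun _ => encodeNat 3)) (fun _ => [])) (wOf l) =
      [decide (l.sum % 3 = 0)] := by
    simp only [Function.comp_apply, fanoutFn_apply, totF_wOf, remFn_boolPair, bitsToNat_encodeNat,
      eqValFn_boolPair, bitsToNat_nil]
  have h3 : (eqValFn ∘ fanoutFn (prodFn ∘ fanoutFn (fun _ => encodeNat 3) bsumF)
      (prodFn ∘ fanoutFn (subFn ∘ fanoutFn (lenBinF ∘ fstF) (fun _ => [true])) totF)) (wOf l) =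
      [decide (3 * coordSumList l = (l.length - 1) * l.sum)] := by
    simp only [Function.comp_apply, fanoutFn_apply, totF_wOf, bsumF_wOf, fstF_wOf, lenBinF_apply,
      List.length_replicate, subFn_boolPair, prodFn_boolPair, bitsToNat_encodeNat, eqValFn_boolPair,
      bitsToNat_cons, bitsToNat_nil, Bool.toNat_true, Nat.mul_zero, Nat.add_zero]
  rw [testFn, andFn_apply h1 (andFn_apply h2 h3)]
  congr 1
  rw [Bool.eq_iff_iff]
  simp only [Good, Bool.and_eq_true, Bool.not_eq_true', decide_eq_false_iff_not, decide_eq_true_eq, ne_eq,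
    List.length_eq_zero_iff, Nat.dvd_iff_mod_eq_zero]

end Values

/-! ### The reduction and the Karp assembly -/

/-- The fixed non-member: the code of the trivial no-instance `[1]`. [cite: FischerIkenmeyer2020, Lemma 5 (proof)] -/
def badCode : List Bool := encodingComposition.encode badList

/-- `badCode` is in neither promise language. [folklore] -/
theorem badCode_not_mem (K : Point → Prop) [DecidablePred K] :
    badCode ∉ encodingComposition.toLanguage (promiseSetK K) := fun h =>
  badList_not_mem_promiseSetK K ((encodingComposition.mem_toLanguage_iff _ _).1 h)

/-- **The reduction of Lemma 5 on strings**: on the code of a composition passing the test, the code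
of `S(P̄_{r-1}) + λ̂`; on every other string, `badCode`. [cite: FischerIkenmeyer2020, Lemma 5 (proof)] -/
def redFn (s : Bool) : List Bool → List Bool := iteFn (andFn isCanonFn testFn) (coreF s) (fun _ => badCode)

/-- **`redFn s ∈ FP`** ("Clearly, this algorithm runs in polynomial time"). [cite: FischerIkenmeyer2020, Lemma 5 (proof)] -/
theorem redFn_mem_FP (s : Bool) : redFn s ∈ FP :=
  iteFn_mem_FP (andFn_mem_FP isCanonFn_mem_FP testFn_mem_FP) (coreF_mem_FP s) (const_mem_FP _)

/-- Value of the reduction on a code. [folklore] -/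
theorem redFn_encode (s : Bool) (l : List ℕ) :
    redFn s (encodingComposition.encode l) =
      if Good l then coreF s (encodingComposition.encode l) else badCode := by
  have hc : isCanonFn (encodingComposition.encode l) = [true] := by
    rw [isCanonFn_apply, decComp_encode]
    simp
  have ht : testFn (encodingComposition.encode l) = [decide (Good l)] := testFn_wOf l
  rw [redFn, iteFn_apply (andFn_apply hc ht)]
  by_cases hg : Good l <;> simp [hg]

/-- Value of the reduction on a non-code. [folklore] -/
theorem redFn_of_not_canon (s : Bool) {x : List Bool} (hx : encodingComposition.encode (decComp x) ≠ x) :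
    redFn s x = badCode := by
  have hc : isCanonFn x = [false] := by
    rw [isCanonFn_apply]
    simp [hx]
  obtain ⟨b, hb⟩ := oneBit_testFn x
  rw [redFn, iteFn_apply (andFn_apply hc hb)]
  simp

/-- **Lemma 5 for a region `K` cut out by the comparisons of the flag `s`**: `redFn s` is a Karp
reduction from the code language of (SKEW-)SYMMETRIC-2D-X-RAY for `K` to that of
PROMISE-(SKEW-)SYMMETRIC-3D-X-RAY for `K`. [cite: FischerIkenmeyer2020, Lemma 5] -/
theorem karpReducible_of_cone (s : Bool) (K : Point → Prop) [DecidablePred K]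
    (hK : ∀ a b c : ℕ, K (a, b, c) ↔ (cmp s b a = true ∧ cmp s c b = true)) :
    encodingComposition.toLanguage (symSetK K) ≤ₚ encodingComposition.toLanguage (promiseSetK K) := by
  refine ⟨redFn s, redFn_mem_FP s, fun x => ?_⟩
  show x ∈ encodingComposition.toLanguage (symSetK K) ↔
    redFn s x ∈ encodingComposition.toLanguage (promiseSetK K)
  by_cases hx : encodingComposition.encode (decComp x) = x
  · rw [← hx, redFn_encode, encodingComposition.mem_toLanguage_iff, mem_symSetK_iff_reduceList_mem K,
      reduceList]
    by_cases hg : Good (decComp x)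
    · rw [if_pos hg, if_pos hg, coreF_encode s _ hK, encodingComposition.mem_toLanguage_iff]
    · rw [if_neg hg, if_neg hg]
      exact ⟨fun h => (badList_not_mem_promiseSetK K h).elim, fun h => (badCode_not_mem K h).elim⟩
  · rw [redFn_of_not_canon s hx]
    exact ⟨fun h => (hx (encode_decComp_of_mem h)).elim, fun h => (badCode_not_mem K h).elim⟩

/-- **SYMMETRIC-2D-X-RAY `≤ₚ` PROMISE-SYMMETRIC-3D-X-RAY** (closed cone, `s = false`).
[cite: FischerIkenmeyer2020, Lemma 5] -/
theorem SYMTWODXRAY_karpReducible : SYMTWODXRAY ≤ₚ PROMISESYMTHREEDXRAY := by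
  rw [SYMTWODXRAY, PROMISESYMTHREEDXRAY, symTwoDXRaySet_eq, promiseSymThreeDXRaySet_eq]
  exact karpReducible_of_cone false IsInClosedCone fun a b c => by simp [IsInClosedCone, cmp]

/-- **SKEW-SYMMETRIC-2D-X-RAY `≤ₚ` PROMISE-SKEW-SYMMETRIC-3D-X-RAY** (open cone, `s = true`).
[cite: FischerIkenmeyer2020, Lemma 5 ("Moreover, …")] -/
theorem SKEWSYMTWODXRAY_karpReducible : SKEWSYMTWODXRAY ≤ₚ PROMISESKEWSYMTHREEDXRAY := by
  rw [SKEWSYMTWODXRAY, PROMISESKEWSYMTHREEDXRAY, skewSymTwoDXRaySet_eq, promiseSkewSymThreeDXRaySet_eq]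
  exact karpReducible_of_cone true IsInOpenCone fun a b c => by simp [IsInOpenCone, cmp]

/-- **Fischer–Ikenmeyer 2020, Lemma 5** (decision form, both cones): the named fact
`FischerIkenmeyer2020_lemma5` of `DiscreteTomography.lean` holds. [cite: FischerIkenmeyer2020, Lemma 5] -/
theorem FischerIkenmeyer2020_lemma5_holds : FischerIkenmeyer2020_lemma5 :=
  ⟨SYMTWODXRAY_karpReducible, SKEWSYMTWODXRAY_karpReducible⟩

end Tomography

end Literature.Computability.Complexity
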